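import Literature.Algebra.Lie.LefschetzModuleKleimanAlgebra
import Mathlib.LinearAlgebra.Dimension.Constructions
import HarnessLib

/-!
# `K[L, ᶜΛ]` is a product of matrix algebras `M_{k+1}(K)` over the string lengths that occur (André 1996, Prop. 1.2, second assertion)

Topic `Literature/Algebra/Lie` (namespace `Literature.Algebra.Lie`).  Lane `lit-hodgefound` (Track 2 foundations library),
prover seat `lit-hodgefound-p34` (generation 30, row g30-#5), a sequel of `LefschetzModuleKleimanAlgebra.lean` (row g30-#1: the four
algebras `K[e, *_L] = K[e, *_H] = K[e, *_L e *_L] = K[e, ᶜΛ]` of André's Prop. 1.2 coincide) and of `LefschetzModuleStringReversal.lean`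
(A1-88's sequel: strings span; the position / co-position projectors `eⁱNⁱ − eⁱ⁺¹Nⁱ⁺¹`, `Nᵗeᵗ − Nᵗ⁺¹eᵗ⁺¹` with `N = *_L e *_L`).
This file proves the SECOND assertion of Prop. 1.2: that algebra is canonically isomorphic to `⊕ M_{k+1}(K)` over the `k` with
`P_{-k} ≠ 0`.  DEFINITIONS WITH BODIES (`primitiveProj`, `stringUnit`, `stringTypes`, `matrixHom`, `matrixEquiv`) and PROVED theorems
only (no named fact, no `sorry`, no instance, no notation; net debt `0`).

## Source, VERBATIM

Y. André, *Pour une théorie inconditionnelle des motifs*, Publ. Math. IHÉS **83** (1996) [Andre1996Motifs] (held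
`paper:doi-10-1007-bf02698643`), Prop. 1.2 (p. 11 = p0008 L62–L66): "Les sous-algèbres `ℚ[L, *_L]`, `ℚ[L, *_H]`, `ℚ[L, *_L L *_L]`,
`ℚ[L, ᶜΛ]` de `End H*(X)` sont égales et contiennent les projecteurs de Künneth. De plus, ces algèbres sont canoniquement isomorphes à
une somme d'algèbres matricielles `M_{i+1}(ℚ)` indexée par les entiers `i` tels que `P^{d-i}(X) ≠ 0`. Via cet isomorphisme, la
transposition relative à la forme bilinéaire `(x, y) ↦ ∫ x ∪ * y` correspond à la transposition des matrices, pour `* = *_L` ou `*_H`.";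
proof (p. 12 = p0009 L5–L13): "soit `P₀ⁱ` une `ℚ`-structure sur le `F`-espace `Pⁱ(X)`, posons `H_ℚ = ⊕ P₀^{d-i} ⊗ ℚ^{i+1}` et munissons
`H_ℚ` d'une structure de `𝔰𝔩₂`-module en identifiant `ℚ^{i+1}` à la puissance symétrique `i`-ème de la représentation standard […]
Puisque les `Sᵢ` sont des représentations absolument irréductibles deux à deux non équivalentes, on en déduit un isomorphisme canonique
`ℚ[L, *_L L *_L] ≅ ⊕ M_{i+1}(ℚ)` (somme indexée par les entiers `i` tels que `P^{d-i}(X) ≠ 0`), tel que l'image de `L` (resp.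
`*_L L *_L`) dans chaque `M_{i+1}(ℚ)` soit la matrice `(m_{ij})` définie par `m_{ij} = 1` si `i = j + 1` (resp. `i = j - 1`), et `= 0`
sinon."

## Rendering (dictionary, continuing g30-#1 and A1-88's sequels)

* A string of LENGTH `k + 1` is `p, e p, …, eᵏ p` with `p ∈ P_{-k}`, `p ≠ 0` (André's `x_i`, `i = d - k`, and its Lefschetz components);
  "les entiers `i` tels que `P^{d-i}(X) ≠ 0`" are the `k` with `primitiveSpace h e k ≠ ⊥` — the finite set `stringTypes` (all `< dim M`).
* "`ℚ^{i+1}`, la puissance symétrique `i`-ème de la représentation standard": the string space `span {eʲ p}` ≅ `K^{k+1}` with basis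
  `eʲ p`; `M_{i+1}(ℚ)` = `Matrix (Fin (k+1)) (Fin (k+1)) K`, the entry `(a, b)` acting by `eᵇ p ↦ eᵃ p` on EVERY string of length
  `k + 1` — the operator `stringUnit k a b = eᵃ ∘ π_k ∘ Nᵇ` (`π_k = primitiveProj k`, the projector onto `P_{-k}` along all other
  string positions and lengths, itself the product of Kleiman's position-`0` and co-position-`k` projectors; `N = *_L e *_L`).
* "un isomorphisme canonique `ℚ[L, *_L L *_L] ≅ ⊕ M_{i+1}(ℚ)`": the algebra map `matrixHom : (Π_{k ∈ stringTypes} M_{k+1}(K)) →ₐ End M`,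
  `(c_k) ↦ Σ c_k[a][b] · stringUnit k a b`, is injective with range `K[e, ᶜΛ]` (`matrixHom_injective`, `range_matrixHom`), whence
  `matrixEquiv : (Π M_{k+1}(K)) ≃ₐ K[e, ᶜΛ]`; "l'image de `L` […] `m_{ij} = 1` si `i = j + 1`": `matrixHom_subdiag = e`,
  `matrixHom_superdiag = *_L e *_L`.

## Contents (all proved unless marked def)

* §1 (def) `primitiveProj`, `primitiveProj_apply_pow_primitive` (`π_k (eʲ p') = [j = 0 ∧ k' = k] p'`), `primitiveProj_apply_primitive`,
  `primitiveProj_mem_adjoin_conj`; (def) `stringUnit`, **`stringUnit_apply_pow_primitive`** (`E⁽ᵏ⁾_{ab} (eʲ p') = [k' = k ∧ j = b] eᵃ p'`),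
  `stringUnit_mem_adjoin_conj`, `stringUnit_mem_adjoin_pair_dual`.
* §2 (def) `stringTypes` (the `k` with `P_{-k} ≠ 0`, all `< dim M`), `mem_stringTypes_iff`, `mem_stringTypes_of_ne_zero`,
  `eq_zero_of_not_mem_stringTypes`; `linearIndependent_string` (the vectors `eᵃ p`, `a ≤ k`, of a non-zero primitive `p` are independent).
* §3 (def) `matrixLinearMap`, `matrixLinearMap_apply`, **`matrixLinearMap_apply_pow_primitive`** (`Φ(c)(eʲ p) = Σ_a c_k[a][j] eᵃ p`),
  `matrixLinearMap_one`, `matrixLinearMap_mul`, (def) **`matrixHom`** (an algebra homomorphism), `matrixHom_apply`,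
  `matrixHom_subdiag` (`= e`), `matrixHom_superdiag` (`= *_L e *_L`).
* §4 **`matrixHom_injective`**, `matrixHom_mem_adjoin_pair_dual`, **`range_matrixHom`** (`= K[e, ᶜΛ]`), (def) **`matrixEquiv`**
  (André's canonical isomorphism), `coe_matrixEquiv_apply`, **`finrank_adjoin_pair_dual`** (`dim K[e, ᶜΛ] = Σ_{k ∈ stringTypes} (k + 1)²`).

The transposition clause (matrix transpose = adjoint for `(x, y) ↦ ∫ x ∪ * y`) is the business of the sequel row (it needs the
self-adjointness file of row g30-#3); concrete carriers are not touched here.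

## References

* [Andre1996Motifs] Y. André, *Pour une théorie inconditionnelle des motifs*, Publ. Math. IHÉS 83 (1996) 5–49, Prop. 1.2 and its proof
  (pp. 11–12).
* [Kleiman1968AlgebraicCycles] S. L. Kleiman, *Algebraic cycles and the Weil conjectures* (1968), §1.4 (1.4.4–1.4.5) — via André.
* [LooijengaLunts1997] E. Looijenga, V. A. Lunts, *A Lie algebra attached to a projective variety*, Invent. Math. 129 (1997), §1 (1.15)
  ("the 𝔰𝔩(2)-type of M").
-/

noncomputable section

namespace Literature.Algebra.Lie

open Module Function Set
open HasLefschetzProperty (primitiveSpace mem_primitiveSpace_iff)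

variable {K : Type*} [Field K] [CharZero K] {M : Type*} [AddCommGroup M] [Module K M] {h e : Module.End K M}

namespace HasLefschetzProperty

/-! ### §1 The projector onto `P_{-k}` and the matrix units `E⁽ᵏ⁾_{ab}`, as elements of `K[e, *_L e *_L]` -/

/-- **The projector `π_k` of `M` onto the primitive part `P_{-k}`** along all the other string vectors: the product of Kleiman's
position-`0` projector `1 − e N` and co-position-`k` projector `Nᵏeᵏ − Nᵏ⁺¹eᵏ⁺¹` (`N = *_L e *_L`), so that `π_k (eʲ p') = p'` if
`j = 0` and `p' ∈ P_{-k}`, and `= 0` on every other string vector. [cite: Andre1996Motifs, Prop. 1.2 (p. 12, proof: H = ⊕ P^{d-i} ⊗ ℚ^{i+1})]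
[cite: Kleiman1968AlgebraicCycles, §1.4, 1.4.4] -/
def primitiveProj (L : HasLefschetzProperty h e) (hgr : IsZGrading h) (k : ℕ) : Module.End K M :=
  (e ^ 0 * (L.lefschetzInvolution hgr * e * L.lefschetzInvolution hgr) ^ 0 -
      e ^ (0 + 1) * (L.lefschetzInvolution hgr * e * L.lefschetzInvolution hgr) ^ (0 + 1)) *
    ((L.lefschetzInvolution hgr * e * L.lefschetzInvolution hgr) ^ k * e ^ k -
      (L.lefschetzInvolution hgr * e * L.lefschetzInvolution hgr) ^ (k + 1) * e ^ (k + 1))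

/-- **`π_k` on a string vector**: `π_k (eʲ p') = p'` if `j = 0` and the string has length `k + 1`, else `0`.
[cite: Andre1996Motifs, Prop. 1.2 (p. 12, proof)] [cite: Kleiman1968AlgebraicCycles, §1.4, 1.4.4] -/
theorem primitiveProj_apply_pow_primitive (L : HasLefschetzProperty h e) (hgr : IsZGrading h) (k : ℕ) {k' : ℕ} {p' : M}
    (hp' : p' ∈ primitiveSpace h e k') {j : ℕ} (hj : j ≤ k') :
    L.primitiveProj hgr k ((e ^ j) p') = if j = 0 ∧ k' = k then p' else 0 := by
  have hs := L.isStringReversal_lefschetzInvolution hgr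
  rw [primitiveProj, Module.End.mul_apply, hs.coposProj_apply hp' k j]
  by_cases hjk : j + k = k'
  · rw [if_pos hjk, hs.posProj_apply hp' 0 hj]
    by_cases hj0 : j = 0
    · subst hj0
      rw [if_pos rfl, if_pos ⟨rfl, by omega⟩, pow_zero, Module.End.one_apply]
    · rw [if_neg (Ne.symm hj0), if_neg fun h' ↦ hj0 h'.1]
  · rw [if_neg hjk, map_zero, if_neg fun h' ↦ hjk (by omega)]

/-- On a primitive vector of length-type `k`: `π_k p = p`. [cite: Andre1996Motifs, Prop. 1.2 (p. 12, proof)] -/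
theorem primitiveProj_apply_primitive (L : HasLefschetzProperty h e) (hgr : IsZGrading h) {k : ℕ} {p : M}
    (hp : p ∈ primitiveSpace h e k) : L.primitiveProj hgr k p = p := by
  have h1 := L.primitiveProj_apply_pow_primitive hgr k hp (Nat.zero_le k) (j := 0)
  rwa [pow_zero, Module.End.one_apply, if_pos ⟨rfl, rfl⟩] at h1

/-- `π_k ∈ K[e, *_L e *_L]`. [cite: Andre1996Motifs, Prop. 1.2 (p. 11)] -/
theorem primitiveProj_mem_adjoin_conj (L : HasLefschetzProperty h e) (hgr : IsZGrading h) (k : ℕ) :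
    L.primitiveProj hgr k ∈ Algebra.adjoin K
      ({e, L.lefschetzInvolution hgr * e * L.lefschetzInvolution hgr} : Set (Module.End K M)) := by
  set N := L.lefschetzInvolution hgr * e * L.lefschetzInvolution hgr
  have he : e ∈ Algebra.adjoin K ({e, N} : Set (Module.End K M)) := Algebra.subset_adjoin (Set.mem_insert _ _)
  have hN : N ∈ Algebra.adjoin K ({e, N} : Set (Module.End K M)) := Algebra.subset_adjoin (Set.mem_insert_of_mem _ rfl)
  refine Subalgebra.mul_mem _ (Subalgebra.sub_mem _ ?_ ?_) (Subalgebra.sub_mem _ ?_ ?_) <;>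
    exact Subalgebra.mul_mem _ (Subalgebra.pow_mem _ ‹_› _) (Subalgebra.pow_mem _ ‹_› _)

/-- **The matrix unit `E⁽ᵏ⁾_{ab} = eᵃ ∘ π_k ∘ Nᵇ`**: on the strings of length `k + 1` it sends `eᵇ p ↦ eᵃ p` and kills the other
positions; it kills all strings of other lengths ("`M_{i+1}(ℚ)`" acting on `P^{d-i} ⊗ ℚ^{i+1}`). [cite: Andre1996Motifs, Prop. 1.2 (p. 12, proof)] -/
def stringUnit (L : HasLefschetzProperty h e) (hgr : IsZGrading h) (k a b : ℕ) : Module.End K M :=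
  e ^ a * L.primitiveProj hgr k * (L.lefschetzInvolution hgr * e * L.lefschetzInvolution hgr) ^ b

/-- **`E⁽ᵏ⁾_{ab}` on a string vector**: `E⁽ᵏ⁾_{ab} (eʲ p') = eᵃ p'` if the string has length `k + 1` and `j = b`, else `0`.
[cite: Andre1996Motifs, Prop. 1.2 (p. 12, proof)] -/
theorem stringUnit_apply_pow_primitive (L : HasLefschetzProperty h e) (hgr : IsZGrading h) (k a b : ℕ) {k' : ℕ} {p' : M}
    (hp' : p' ∈ primitiveSpace h e k') {j : ℕ} (hj : j ≤ k') :
    L.stringUnit hgr k a b ((e ^ j) p') = if k' = k ∧ j = b then (e ^ a) p' else 0 := by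
  have hs := L.isStringReversal_lefschetzInvolution hgr
  rw [stringUnit, Module.End.mul_apply, Module.End.mul_apply, hs.conj_pow_apply_pow_primitive hp' b hj]
  by_cases hbj : b ≤ j
  · rw [if_pos hbj, L.primitiveProj_apply_pow_primitive hgr k hp' (show j - b ≤ k' by omega)]
    by_cases hm : k' = k ∧ j = b
    · rw [if_pos ⟨by omega, hm.1⟩, if_pos hm]
    · rw [if_neg fun h' ↦ hm ⟨h'.2, by omega⟩, if_neg hm, map_zero]
  · rw [if_neg hbj, map_zero, map_zero, if_neg fun h' ↦ hbj h'.2.symm.le]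

/-- `E⁽ᵏ⁾_{ab} ∈ K[e, *_L e *_L]`. [cite: Andre1996Motifs, Prop. 1.2 (p. 11)] -/
theorem stringUnit_mem_adjoin_conj (L : HasLefschetzProperty h e) (hgr : IsZGrading h) (k a b : ℕ) :
    L.stringUnit hgr k a b ∈ Algebra.adjoin K
      ({e, L.lefschetzInvolution hgr * e * L.lefschetzInvolution hgr} : Set (Module.End K M)) := by
  set N := L.lefschetzInvolution hgr * e * L.lefschetzInvolution hgr with hN
  have he : e ∈ Algebra.adjoin K ({e, N} : Set (Module.End K M)) := Algebra.subset_adjoin (Set.mem_insert _ _)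
  have hN' : N ∈ Algebra.adjoin K ({e, N} : Set (Module.End K M)) := Algebra.subset_adjoin (Set.mem_insert_of_mem _ rfl)
  have hπ : L.primitiveProj hgr k ∈ Algebra.adjoin K ({e, N} : Set (Module.End K M)) := L.primitiveProj_mem_adjoin_conj hgr k
  have h1 : e ^ a * L.primitiveProj hgr k * N ^ b ∈ Algebra.adjoin K ({e, N} : Set (Module.End K M)) :=
    Subalgebra.mul_mem _ (Subalgebra.mul_mem _ (Subalgebra.pow_mem _ he _) hπ) (Subalgebra.pow_mem _ hN' _)
  exact h1

/-! ### §2 The string lengths that occur; a string is a linearly independent family -/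

variable [FiniteDimensional K M]

/-- `E⁽ᵏ⁾_{ab} ∈ K[e, ᶜΛ]` (the same algebra, row g30-#1). [cite: Andre1996Motifs, Prop. 1.2 (p. 11)] -/
theorem stringUnit_mem_adjoin_pair_dual (L : HasLefschetzProperty h e) (hgr : IsZGrading h) (k a b : ℕ) :
    L.stringUnit hgr k a b ∈ Algebra.adjoin K ({e, L.dual hgr} : Set (Module.End K M)) := by
  rw [← L.adjoin_pair_conj_lefschetzInvolution_eq_adjoin_pair_dual hgr]
  exact L.stringUnit_mem_adjoin_conj hgr k a b

/-- **"les entiers `i` tels que `P^{d-i}(X) ≠ 0`"**: the set of `k` such that strings of length `k + 1` occur, `P_{-k} ≠ 0`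
(all `< dim M`). [cite: Andre1996Motifs, Prop. 1.2 (p. 11)] [cite: LooijengaLunts1997, §1 (1.15) ("the 𝔰𝔩(2)-type of M")] -/
def stringTypes (h e : Module.End K M) : Finset ℕ :=
  open Classical in (Finset.range (Module.finrank K M)).filter fun k ↦ primitiveSpace h e k ≠ ⊥

/-- Membership in `stringTypes`. [cite: Andre1996Motifs, Prop. 1.2 (p. 11)] -/
theorem mem_stringTypes_iff (L : HasLefschetzProperty h e) {k : ℕ} : k ∈ stringTypes h e ↔ primitiveSpace h e k ≠ ⊥ := by
  classical
  rw [stringTypes, Finset.mem_filter, Finset.mem_range, and_iff_right_iff_imp]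
  intro hk
  by_contra hlt
  apply hk
  rw [Submodule.eq_bot_iff]
  exact fun p hp ↦ L.eq_zero_of_mem_primitiveSpace_of_finrank_le (not_lt.1 hlt) hp

/-- A non-zero primitive vector witnesses its length. [cite: Andre1996Motifs, Prop. 1.2 (p. 11)] -/
theorem mem_stringTypes_of_ne_zero (L : HasLefschetzProperty h e) {k : ℕ} {p : M} (hp : p ∈ primitiveSpace h e k) (hp0 : p ≠ 0) :
    k ∈ stringTypes h e := by
  rw [L.mem_stringTypes_iff]
  intro hbot
  rw [hbot, Submodule.mem_bot] at hp
  exact hp0 hp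

omit [FiniteDimensional K M] in
/-- **A string is linearly independent**: for `p ∈ P_{-k}`, `p ≠ 0`, the vectors `eᵃ p`, `a ≤ k`, are linearly independent (they are
non-zero — `eᵏ : M_{-k} ≅ M_k` — eigenvectors of `h` for the distinct eigenvalues `-k + 2a`).
[cite: Andre1996Motifs, Prop. 1.2 (p. 12, proof: "ℚ^{i+1}")] [cite: LooijengaLunts1997, §1 (1.1)] -/
theorem linearIndependent_string (L : HasLefschetzProperty h e) {k : ℕ} {p : M} (hp : p ∈ primitiveSpace h e k) (hp0 : p ≠ 0) :
    LinearIndependent K fun a : Fin (k + 1) ↦ (e ^ (a : ℕ)) p := by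
  have hpk := (mem_primitiveSpace_iff.1 hp).1
  refine Module.End.eigenvectors_linearIndependent' h (fun a : Fin (k + 1) ↦ ((-(k : ℤ) + 2 * (a : ℕ) : ℤ) : K))
    (fun a b hab ↦ ?_) _ fun a ↦ ⟨L.pow_apply_mem hpk a, fun h0 ↦ hp0 ?_⟩
  · beta_reduce at hab
    have h1 : (-(k : ℤ) + 2 * (a : ℕ) : ℤ) = -(k : ℤ) + 2 * (b : ℕ) := Int.cast_injective hab
    exact Fin.ext (by omega)
  · -- `eᵃ p = 0` with `a ≤ k` forces `eᵏ p = 0`, hence `p = 0`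
    refine L.eq_zero_of_pow_apply_eq_zero (n := (k : ℤ)) (by omega) hpk ?_
    rw [Int.toNat_natCast]
    obtain ⟨c, hc⟩ := Nat.exists_eq_add_of_le (show (a : ℕ) ≤ k by omega)
    rw [hc, add_comm, pow_add, Module.End.mul_apply, h0, map_zero]

/-! ### §3 The algebra homomorphism `Φ : Π_{k ∈ stringTypes} M_{k+1}(K) → End M` -/

/-- The linear map `(c_k)_k ↦ Σ_k Σ_{a,b} c_k[a][b] · E⁽ᵏ⁾_{ab}` underlying André's isomorphism. [cite: Andre1996Motifs, Prop. 1.2 (p. 12, proof)] -/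
def matrixLinearMap (L : HasLefschetzProperty h e) (hgr : IsZGrading h) :
    ((k : stringTypes h e) → Matrix (Fin ((k : ℕ) + 1)) (Fin ((k : ℕ) + 1)) K) →ₗ[K] Module.End K M where
  toFun c := ∑ k : stringTypes h e, ∑ a : Fin ((k : ℕ) + 1), ∑ b : Fin ((k : ℕ) + 1), c k a b • L.stringUnit hgr k a b
  map_add' c d := by simp only [Pi.add_apply, Matrix.add_apply, add_smul, Finset.sum_add_distrib]
  map_smul' r c := by simp only [Pi.smul_apply, Matrix.smul_apply, smul_eq_mul, mul_smul, RingHom.id_apply, Finset.smul_sum]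

omit [FiniteDimensional K M] in
/-- Unfolding `Φ`. [cite: Andre1996Motifs, Prop. 1.2 (p. 12, proof)] -/
theorem matrixLinearMap_apply (L : HasLefschetzProperty h e) (hgr : IsZGrading h)
    (c : (k : stringTypes h e) → Matrix (Fin ((k : ℕ) + 1)) (Fin ((k : ℕ) + 1)) K) :
    L.matrixLinearMap hgr c =
      ∑ k : stringTypes h e, ∑ a : Fin ((k : ℕ) + 1), ∑ b : Fin ((k : ℕ) + 1), c k a b • L.stringUnit hgr k a b := rfl

omit [FiniteDimensional K M] in
/-- **`Φ(c)` on a string vector**: for `p ∈ P_{-k}` (`k` an occurring length) and `j ≤ k`, `Φ(c)(eʲ p) = Σ_a c_k[a][j] · eᵃ p` — the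
matrix `c_k` acting on the string through `p` in the basis `p, e p, …, eᵏ p` ("en identifiant `ℚ^{i+1}` à la puissance symétrique").
[cite: Andre1996Motifs, Prop. 1.2 (p. 12, proof)] -/
theorem matrixLinearMap_apply_pow_primitive (L : HasLefschetzProperty h e) (hgr : IsZGrading h)
    (c : (k : stringTypes h e) → Matrix (Fin ((k : ℕ) + 1)) (Fin ((k : ℕ) + 1)) K) {k : ℕ} (hk : k ∈ stringTypes h e) {p : M}
    (hp : p ∈ primitiveSpace h e k) {j : ℕ} (hj : j ≤ k) :
    L.matrixLinearMap hgr c ((e ^ j) p) = ∑ a : Fin (k + 1), c ⟨k, hk⟩ a ⟨j, Nat.lt_succ_of_le hj⟩ • (e ^ (a : ℕ)) p := by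
  rw [matrixLinearMap_apply, LinearMap.sum_apply,
    Finset.sum_eq_single_of_mem (⟨k, hk⟩ : stringTypes h e) (Finset.mem_univ _) fun k₁ _ hk₁ ↦ ?_]
  · -- the block `k`: `Σ_a Σ_b c[a][b] [j = b] eᵃ p = Σ_a c[a][j] eᵃ p`
    rw [LinearMap.sum_apply]
    refine Finset.sum_congr rfl fun a _ ↦ ?_
    rw [LinearMap.sum_apply, Finset.sum_eq_single_of_mem (⟨j, Nat.lt_succ_of_le hj⟩ : Fin (k + 1)) (Finset.mem_univ _)
      fun b _ hb ↦ ?_]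
    · rw [LinearMap.smul_apply, L.stringUnit_apply_pow_primitive hgr _ _ _ hp hj, if_pos ⟨rfl, rfl⟩]
    · rw [LinearMap.smul_apply, L.stringUnit_apply_pow_primitive hgr _ _ _ hp hj,
        if_neg fun h' ↦ hb (Fin.ext h'.2.symm), smul_zero]
  · -- the other blocks kill the string
    have hne : k ≠ (k₁ : ℕ) := fun h' ↦ hk₁ (Subtype.ext h'.symm)
    rw [LinearMap.sum_apply]
    refine Finset.sum_eq_zero fun a _ ↦ ?_
    rw [LinearMap.sum_apply]
    refine Finset.sum_eq_zero fun b _ ↦ ?_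
    rw [LinearMap.smul_apply, L.stringUnit_apply_pow_primitive hgr _ _ _ hp hj, if_neg fun h' ↦ hne h'.1, smul_zero]

/-- Outside the occurring lengths there is nothing to act on: `P_{-k} = 0` for `k ∉ stringTypes`. [cite: Andre1996Motifs, Prop. 1.2 (p. 11)] -/
theorem eq_zero_of_not_mem_stringTypes (L : HasLefschetzProperty h e) {k : ℕ} (hk : k ∉ stringTypes h e) {p : M}
    (hp : p ∈ primitiveSpace h e k) : p = 0 := by
  by_contra hp0
  exact hk (L.mem_stringTypes_of_ne_zero hp hp0)

/-- `Φ(1) = 1` (`Σ_k Σ_a E⁽ᵏ⁾_{aa}` is the identity: it fixes every string vector). [cite: Andre1996Motifs, Prop. 1.2 (p. 12, proof)] -/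
theorem matrixLinearMap_one (L : HasLefschetzProperty h e) (hgr : IsZGrading h) : L.matrixLinearMap hgr 1 = 1 := by
  refine L.linearMap_ext_of_strings hgr fun k p hp j hj ↦ ?_
  by_cases hk : k ∈ stringTypes h e
  · rw [L.matrixLinearMap_apply_pow_primitive hgr 1 hk hp hj, Module.End.one_apply,
      Finset.sum_eq_single_of_mem (⟨j, by omega⟩ : Fin (k + 1)) (Finset.mem_univ _) fun a _ ha ↦ by
        rw [Pi.one_apply, Matrix.one_apply_ne ha, zero_smul]]
    rw [Pi.one_apply, Matrix.one_apply_eq, one_smul]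
  · rw [L.eq_zero_of_not_mem_stringTypes hk hp, map_zero, map_zero, map_zero]

/-- `Φ(c d) = Φ(c) Φ(d)` (matrix multiplication is composition on each string). [cite: Andre1996Motifs, Prop. 1.2 (p. 12, proof)] -/
theorem matrixLinearMap_mul (L : HasLefschetzProperty h e) (hgr : IsZGrading h)
    (c d : (k : stringTypes h e) → Matrix (Fin ((k : ℕ) + 1)) (Fin ((k : ℕ) + 1)) K) :
    L.matrixLinearMap hgr (c * d) = L.matrixLinearMap hgr c * L.matrixLinearMap hgr d := by
  refine L.linearMap_ext_of_strings hgr fun k p hp j hj ↦ ?_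
  by_cases hk : k ∈ stringTypes h e
  · rw [Module.End.mul_apply, L.matrixLinearMap_apply_pow_primitive hgr d hk hp hj, map_sum,
      L.matrixLinearMap_apply_pow_primitive hgr (c * d) hk hp hj]
    have h1 : ∀ a' : Fin (k + 1),
        L.matrixLinearMap hgr c (d ⟨k, hk⟩ a' ⟨j, Nat.lt_succ_of_le hj⟩ • (e ^ (a' : ℕ)) p) =
          ∑ a : Fin (k + 1), (d ⟨k, hk⟩ a' ⟨j, Nat.lt_succ_of_le hj⟩ * c ⟨k, hk⟩ a a') • (e ^ (a : ℕ)) p := fun a' ↦ by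
      rw [map_smul, L.matrixLinearMap_apply_pow_primitive hgr c hk hp (Nat.le_of_lt_succ a'.2), Finset.smul_sum]
      simp only [Fin.eta, smul_smul]
    simp only [h1]
    rw [Finset.sum_comm]
    refine Finset.sum_congr rfl fun a _ ↦ ?_
    rw [Pi.mul_apply, Matrix.mul_apply, Finset.sum_smul]
    refine Finset.sum_congr rfl fun a' _ ↦ ?_
    rw [mul_comm]
  · rw [L.eq_zero_of_not_mem_stringTypes hk hp, map_zero, map_zero, map_zero]

/-- **André's canonical map `Φ : Π_{k ∈ stringTypes} M_{k+1}(K) → End M`** as an algebra homomorphism. [cite: Andre1996Motifs, Prop. 1.2 (pp. 11–12)] -/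
def matrixHom (L : HasLefschetzProperty h e) (hgr : IsZGrading h) :
    ((k : stringTypes h e) → Matrix (Fin ((k : ℕ) + 1)) (Fin ((k : ℕ) + 1)) K) →ₐ[K] Module.End K M :=
  AlgHom.ofLinearMap (L.matrixLinearMap hgr) (L.matrixLinearMap_one hgr) (L.matrixLinearMap_mul hgr)

/-- `Φ` is the linear map `matrixLinearMap`. [cite: Andre1996Motifs, Prop. 1.2 (pp. 11–12)] -/
theorem matrixHom_apply (L : HasLefschetzProperty h e) (hgr : IsZGrading h)
    (c : (k : stringTypes h e) → Matrix (Fin ((k : ℕ) + 1)) (Fin ((k : ℕ) + 1)) K) :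
    L.matrixHom hgr c = L.matrixLinearMap hgr c := rfl

/-- **"l'image de `L` […] dans chaque `M_{i+1}(ℚ)` soit la matrice `m_{ij} = 1` si `i = j + 1`"**: `Φ` of the family of sub-diagonal
matrices is `e`. [cite: Andre1996Motifs, Prop. 1.2 (p. 12, proof)] -/
theorem matrixHom_subdiag (L : HasLefschetzProperty h e) (hgr : IsZGrading h) :
    L.matrixHom hgr (fun _ a b ↦ if (a : ℕ) = (b : ℕ) + 1 then 1 else 0) = e := by
  rw [matrixHom_apply]
  refine L.linearMap_ext_of_strings hgr fun k p hp j hj ↦ ?_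
  by_cases hk : k ∈ stringTypes h e
  · rw [L.matrixLinearMap_apply_pow_primitive hgr _ hk hp hj, ← Module.End.mul_apply, ← pow_succ']
    by_cases hjk : j + 1 ≤ k
    · rw [Finset.sum_eq_single_of_mem (⟨j + 1, by omega⟩ : Fin (k + 1)) (Finset.mem_univ _) fun a _ ha ↦ by
          rw [if_neg fun h' ↦ ha (Fin.ext h'), zero_smul]]
      rw [if_pos rfl, one_smul]
    · obtain rfl : j = k := by omega
      rw [(mem_primitiveSpace_iff.1 hp).2]
      exact Finset.sum_eq_zero fun a _ ↦ by
        rw [if_neg (fun h' ↦ by have h2 : (a : ℕ) < j + 1 := a.2; have h3 : (a : ℕ) = j + 1 := h'; omega), zero_smul]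
  · rw [L.eq_zero_of_not_mem_stringTypes hk hp, map_zero, map_zero, map_zero]

/-- **"… resp. `*_L L *_L` […] `m_{ij} = 1` si `i = j - 1`"**: `Φ` of the family of super-diagonal matrices is `N = *_L e *_L`.
[cite: Andre1996Motifs, Prop. 1.2 (p. 12, proof)] -/
theorem matrixHom_superdiag (L : HasLefschetzProperty h e) (hgr : IsZGrading h) :
    L.matrixHom hgr (fun _ a b ↦ if (b : ℕ) = (a : ℕ) + 1 then 1 else 0) =
      L.lefschetzInvolution hgr * e * L.lefschetzInvolution hgr := by
  rw [matrixHom_apply]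
  refine L.linearMap_ext_of_strings hgr fun k p hp j hj ↦ ?_
  by_cases hk : k ∈ stringTypes h e
  · rw [L.matrixLinearMap_apply_pow_primitive hgr _ hk hp hj,
      (L.isStringReversal_lefschetzInvolution hgr).conj_apply_pow_primitive hp hj]
    by_cases hj0 : j = 0
    · subst hj0
      rw [if_pos rfl]
      exact Finset.sum_eq_zero fun a _ ↦ by rw [if_neg (fun h' ↦ by have h3 : 0 = (a : ℕ) + 1 := h'; omega), zero_smul]
    · rw [if_neg hj0, Finset.sum_eq_single_of_mem (⟨j - 1, by omega⟩ : Fin (k + 1)) (Finset.mem_univ _) fun a _ ha ↦ by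
          rw [if_neg fun h' ↦ ha (Fin.ext (show (a : ℕ) = j - 1 by have h3 : j = (a : ℕ) + 1 := h'; omega)), zero_smul]]
      rw [if_pos (show j = (j - 1) + 1 by omega), one_smul]
  · rw [L.eq_zero_of_not_mem_stringTypes hk hp, map_zero, map_zero, map_zero]

/-! ### §4 `Φ` is injective with range `K[e, ᶜΛ]`: André's isomorphism and the dimension of `K[e, ᶜΛ]` -/

/-- **`Φ` is injective** (a string of length `k + 1` is a linearly independent family, so `Σ_a c_k[a][j] eᵃ p = 0` with `p ≠ 0` forces
`c_k[·][j] = 0`). [cite: Andre1996Motifs, Prop. 1.2 (p. 12, proof)] -/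
theorem matrixHom_injective (L : HasLefschetzProperty h e) (hgr : IsZGrading h) : Function.Injective (L.matrixHom hgr) := by
  rw [injective_iff_map_eq_zero]
  intro c hc
  funext k a b
  obtain ⟨k, hk⟩ := k
  obtain ⟨p, hp, hp0⟩ := (Submodule.ne_bot_iff _).1 ((L.mem_stringTypes_iff).1 hk)
  have h1 := LinearMap.congr_fun hc ((e ^ (b : ℕ)) p)
  rw [matrixHom_apply, L.matrixLinearMap_apply_pow_primitive hgr c hk hp (Nat.le_of_lt_succ b.2), LinearMap.zero_apply] at h1
  have h2 := Fintype.linearIndependent_iff.1 (L.linearIndependent_string hp hp0) _ h1 a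
  simpa using h2

/-- `Φ` takes values in `K[e, ᶜΛ]`. [cite: Andre1996Motifs, Prop. 1.2 (p. 11)] -/
theorem matrixHom_mem_adjoin_pair_dual (L : HasLefschetzProperty h e) (hgr : IsZGrading h)
    (c : (k : stringTypes h e) → Matrix (Fin ((k : ℕ) + 1)) (Fin ((k : ℕ) + 1)) K) :
    L.matrixHom hgr c ∈ Algebra.adjoin K ({e, L.dual hgr} : Set (Module.End K M)) := by
  rw [matrixHom_apply, matrixLinearMap, LinearMap.coe_mk, AddHom.coe_mk]
  exact Subalgebra.sum_mem _ fun k _ ↦ Subalgebra.sum_mem _ fun a _ ↦ Subalgebra.sum_mem _ fun b _ ↦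
    Subalgebra.smul_mem _ (L.stringUnit_mem_adjoin_pair_dual hgr k a b) _

/-- **The range of `Φ` is `K[e, ᶜΛ]`** (`⊆`: the matrix units lie in `K[e, *_L e *_L] = K[e, ᶜΛ]`; `⊇`: `e = Φ(subdiag)`,
`*_L e *_L = Φ(superdiag)` and `ᶜΛ ∈ K[e, *_L e *_L]`, Kleiman 1.4.4). [cite: Andre1996Motifs, Prop. 1.2 (pp. 11–12)]
[cite: Kleiman1968AlgebraicCycles, §1.4, 1.4.4] -/
theorem range_matrixHom (L : HasLefschetzProperty h e) (hgr : IsZGrading h) :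
    (L.matrixHom hgr).range = Algebra.adjoin K ({e, L.dual hgr} : Set (Module.End K M)) := by
  refine le_antisymm ?_ ?_
  · rintro x ⟨c, rfl⟩
    exact L.matrixHom_mem_adjoin_pair_dual hgr c
  · have he : e ∈ (L.matrixHom hgr).range := ⟨_, L.matrixHom_subdiag hgr⟩
    have hN : L.lefschetzInvolution hgr * e * L.lefschetzInvolution hgr ∈ (L.matrixHom hgr).range :=
      ⟨_, L.matrixHom_superdiag hgr⟩
    have hle : Algebra.adjoin K ({e, L.lefschetzInvolution hgr * e * L.lefschetzInvolution hgr} : Set (Module.End K M)) ≤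
        (L.matrixHom hgr).range := by
      refine Algebra.adjoin_le ?_
      rintro x (rfl | rfl)
      · exact he
      · exact hN
    refine Algebra.adjoin_le ?_
    rintro x (rfl | rfl)
    · exact he
    · exact hle (L.dual_mem_adjoin_conj_lefschetzInvolution hgr)

/-- **ANDRÉ'S CANONICAL ISOMORPHISM `Π_{k ∈ stringTypes} M_{k+1}(K) ≅ K[L, ᶜΛ]`** ("ces algèbres sont canoniquement isomorphes à une
somme d'algèbres matricielles `M_{i+1}(ℚ)` indexée par les entiers `i` tels que `P^{d-i}(X) ≠ 0`"). [cite: Andre1996Motifs, Prop. 1.2 (pp. 11–12)] -/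
def matrixEquiv (L : HasLefschetzProperty h e) (hgr : IsZGrading h) :
    ((k : stringTypes h e) → Matrix (Fin ((k : ℕ) + 1)) (Fin ((k : ℕ) + 1)) K) ≃ₐ[K]
      ↥(Algebra.adjoin K ({e, L.dual hgr} : Set (Module.End K M))) :=
  (AlgEquiv.ofInjective (L.matrixHom hgr) (L.matrixHom_injective hgr)).trans
    (Subalgebra.equivOfEq _ _ (L.range_matrixHom hgr))

/-- The isomorphism is `Φ`: `(matrixEquiv c : End M) = Φ(c)`. [cite: Andre1996Motifs, Prop. 1.2 (pp. 11–12)] -/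
theorem coe_matrixEquiv_apply (L : HasLefschetzProperty h e) (hgr : IsZGrading h)
    (c : (k : stringTypes h e) → Matrix (Fin ((k : ℕ) + 1)) (Fin ((k : ℕ) + 1)) K) :
    (L.matrixEquiv hgr c : Module.End K M) = L.matrixHom hgr c := rfl

/-- **`dim_K K[L, ᶜΛ] = Σ_{k ∈ stringTypes} (k + 1)²`.** [cite: Andre1996Motifs, Prop. 1.2 (p. 11)] -/
theorem finrank_adjoin_pair_dual (L : HasLefschetzProperty h e) (hgr : IsZGrading h) :
    Module.finrank K ↥(Algebra.adjoin K ({e, L.dual hgr} : Set (Module.End K M))) =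
      ∑ k ∈ stringTypes h e, (k + 1) ^ 2 := by
  rw [← (L.matrixEquiv hgr).toLinearEquiv.finrank_eq, Module.finrank_pi_fintype K, ← Finset.sum_coe_sort (stringTypes h e)]
  refine Finset.sum_congr rfl fun k _ ↦ ?_
  rw [Module.finrank_matrix, Module.finrank_self, Fintype.card_fin, mul_one, sq]

end HasLefschetzProperty

end Literature.Algebra.Lie

end
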